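import Summits.QuantumAdvantage.AdviceFreeQNC0.FibreDecimation37SubRow
import Summits.QuantumAdvantage.AdviceFreeQNC0.FibreDecimation37MixedCount
import Summits.QuantumAdvantage.AdviceFreeQNC0.SubRowDecimation38C
import HarnessLib

/-!
# Cell qa-qnc0, `p = 3` — ROUND-38P2 **Theorem 38.F (corrected form) PROVED**: `Exp38p2.FibreNonExact38E` (memo-exact, (NH_{s₀}) at the
# set `J'_ε` actually expanded) and `Exp38p2.FibreNonExact38R` (syntactic form), via `Exp38p2.SubrowNonconst` (Lemma 38.A (ii))

Planner qa-qnc0-p2 g38, ROUND-38P2 §1.3 / §8 N2 (typed in the custody delta `SubRowDecimation38C.lean`, ported as a tree file): the fibre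
theorem of gen 38 — SUB-ROW base row (`a`-compatible, ≥ 2 support coins) and the MIXED-NORM third step (relations of support `≤ s₀` are
paid by their `L¹` mass `S(|J'_ε|, s₀)`, longer ones by Parseval against the `3/4`-mass).  Proof = the 37.F′ pipeline of this directory with
(a) `FibreDecimation37SubRow` (Lemma 38.A (ii)) and (b) `FibreDecimation37MixedCount.card_parityClass_filter_le_mixed` (Lemma 38.C); the
decoded tests are GENUINE exactly on `J'_ε = decimSetE` and trivial elsewhere once the rows not meeting `Y` are replaced by the constants
they contribute (`trivA`, `filter_trivA_eq`).

* `psi_nonconst_right`, **`subrowNonconst : SubrowNonconst`** (both signs: `δ` or `−δ` compatible with ≥ 2 support coins ⇒ genuine);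
* `trivA`, `mem_trivA_iff`, `trivA_proper_of_mem`, `trivA_not_proper_of_not_mem` (genuine exactly on `J'_ε`);
* `card_parityClass_filter_le_mixed'` (the count for an arbitrary presentation of the long-pattern index set), `nhsE_long_sum_le`;
* **`fibreNonExact38E : FibreNonExact38E`**, **`fibreNonExact38R : FibreNonExact38R`** (via p2's `fibreNonExact38R_of_E`).

WHAT THIS IS NOT: Corollary 38.E / Theorem 38.N (iterated rounds) / Conjecture 38.L untouched; crux 22907 untouched; no separation claim.
-/

noncomputable section

open Classical

namespace Summit.QuantumAdvantage.AdviceFreeQNC0.Exp38p2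

open Finset
open Summit.QuantumAdvantage.AdviceFreeQNC0 F4
open Summit.QuantumAdvantage.AdviceFreeQNC0.Exp37
open Literature.Computability.MetaComplexity Literature.Computability.MetaComplexity.ModTestProduct

/-! ### Lemma 38.A (ii) as the inclusion `decimSetNC ⊆ decimSetE` -/

/-- A decoded test with `A = 0`, `B ≠ 0` is genuine too (`t ↦ 2t` is a bijection of `ℤ/3`). -/
theorem psi_nonconst_right {θ B : F4} (hθ : IsUnit θ) (hB : B ≠ 0) : ∃ t t' : ZMod 3, psi θ 0 B t ≠ psi θ 0 B t' := by
  have hc : θ * B ≠ 0 := by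
    intro h
    obtain ⟨u, hu⟩ := hθ
    have : B = 0 := by
      calc B = (↑u⁻¹ * ↑u) * B := by rw [Units.inv_mul, one_mul]
        _ = ↑u⁻¹ * (θ * B) := by rw [hu, mul_assoc]
        _ = 0 := by rw [h, mul_zero]
    exact hB this
  obtain ⟨t, t', h⟩ := tr_mul_pow_nonconst hc
  refine ⟨2 * t, 2 * t', ?_⟩
  have hval : ∀ τ : ZMod 3, ω ^ (2 * (2 * τ).val) = ω ^ τ.val := by
    intro τ
    rw [omega_pow_mod (2 * (2 * τ).val), omega_pow_mod τ.val, ZMod.val_mul]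
    congr 1
    have : (2 : ZMod 3).val = 2 := rfl
    rw [this]
    have hτ := ZMod.val_lt τ
    omega
  unfold psi
  rw [mul_zero, zero_add, mul_zero, zero_add, hval t, hval t', ← mul_assoc, ← mul_assoc, mul_right_comm θ _ B,
    mul_right_comm θ _ B]
  exact h

/-- **Lemma 38.A (ii) (`SubrowNonconst`) — PROVED**: a decimated row meeting `Y` with `±δ_k` `a`-compatible and `≥ 2` support coins decodes
to a genuine test, for every coset parity `ε` (`m` odd). -/
theorem subrowNonconst : SubrowNonconst := by
  intro z s m ι a β ε hm k hk
  unfold decimSetNC at hk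
  unfold decimSetE
  rw [mem_filter] at hk ⊢
  obtain ⟨hkY, hcomp, h2⟩ := hk
  refine ⟨hkY, ?_⟩
  rcases hcomp with hc | hc
  · rw [coefA_neg_subrow a ε hc h2]
    exact psi_nonconst (isUnit_theta a ε hm) (coefA_subrow_ne_zero a ε hc hm)
  · have h2' : 2 ≤ (univ.filter fun i : Fin m => (-restrictM ι β k) i ≠ 0).card := by
      have e : (univ.filter fun i : Fin m => (-restrictM ι β k) i ≠ 0) = univ.filter fun i : Fin m => β k (ι i) ≠ 0 := by
        refine filter_congr fun i _ => ?_
        rw [Pi.neg_apply, neg_ne_zero]; rfl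
      rw [e]; exact h2
    have hA : coefA a ε (restrictM ι β k) = 0 := by
      have h := coefA_neg_subrow a ε hc h2'
      rwa [neg_neg] at h
    rw [hA]
    exact psi_nonconst_right (isUnit_theta a ε hm) (coefA_subrow_ne_zero a ε hc hm)

/-! ### Genuine exactly on `J'_ε`: trivialising the rows that do not meet `Y` -/

variable {z s m : ℕ}

/-- The decoded accepting sets with the rows NOT meeting `Y` replaced by the constants they contribute. -/
def trivA (ι : Fin m ↪ Fin z) (β : Fin s → Fin z → ZMod 3) (r : Fin s → ZMod 3) (a : Fin m → Bool) (ε : ℕ) (k : Fin s) :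
    Finset (ZMod 3) :=
  if (∀ c : Out ι, β k c.1 = 0) then (if (0 : ZMod 3) ∈ accSet ι β r a ε k then univ else ∅) else accSet ι β r a ε k

/-- A row not meeting `Y` has outside form `0`. -/
theorem subsetSum_dirOut_eq_zero (ι : Fin m ↪ Fin z) (β : Fin s → Fin z → ZMod 3) (k : Fin s)
    (h : ∀ c : Out ι, β k c.1 = 0) (y : Out ι → Bool) : ModTestProduct.subsetSum (dirOut ι β k) y = 0 := by
  unfold ModTestProduct.subsetSum dirOut
  exact sum_eq_zero fun c _ => by rw [h c]; simp

/-- Trivialising does not change which tests fire. -/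
theorem mem_trivA_iff (ι : Fin m ↪ Fin z) (β : Fin s → Fin z → ZMod 3) (r : Fin s → ZMod 3) (a : Fin m → Bool) (ε : ℕ)
    (k : Fin s) (y : Out ι → Bool) :
    ModTestProduct.subsetSum (dirOut ι β k) y ∈ trivA ι β r a ε k ↔ ModTestProduct.subsetSum (dirOut ι β k) y ∈ accSet ι β r a ε k := by
  unfold trivA
  by_cases h : ∀ c : Out ι, β k c.1 = 0
  · rw [if_pos h, subsetSum_dirOut_eq_zero ι β k h y]
    by_cases h0 : (0 : ZMod 3) ∈ accSet ι β r a ε k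
    · rw [if_pos h0]; simp [h0]
    · rw [if_neg h0]; simp [h0]
  · rw [if_neg h]

/-- The firing counts agree. -/
theorem filter_trivA_eq (ι : Fin m ↪ Fin z) (β : Fin s → Fin z → ZMod 3) (r : Fin s → ZMod 3) (a : Fin m → Bool) (ε : ℕ)
    (y : Out ι → Bool) :
    (univ.filter fun k => ModTestProduct.subsetSum (dirOut ι β k) y ∈ trivA ι β r a ε k) =
      univ.filter fun k => ModTestProduct.subsetSum (dirOut ι β k) y ∈ accSet ι β r a ε k :=
  filter_congr fun k _ => mem_trivA_iff ι β r a ε k y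

/-- Membership of `τ + r_k` in `Acc_k` is `ψ_k(τ) = 1`. -/
theorem mem_accSet_iff (ι : Fin m ↪ Fin z) (β : Fin s → Fin z → ZMod 3) (r : Fin s → ZMod 3) (a : Fin m → Bool) (ε : ℕ)
    (k : Fin s) (τ : ZMod 3) :
    τ + r k ∈ accSet ι β r a ε k ↔
      psi (theta a ε) (coefA a ε (restrictM ι β k)) (coefA a ε (-restrictM ι β k)) τ = 1 := by
  unfold accSet
  rw [mem_filter, add_sub_cancel_right]
  simp

/-- A decoded test taking two values is genuine. -/
theorem accSet_proper_of_ne (ι : Fin m ↪ Fin z) (β : Fin s → Fin z → ZMod 3) (r : Fin s → ZMod 3) (a : Fin m → Bool) (ε : ℕ)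
    (k : Fin s) {t t' : ZMod 3}
    (htt : psi (theta a ε) (coefA a ε (restrictM ι β k)) (coefA a ε (-restrictM ι β k)) t ≠
      psi (theta a ε) (coefA a ε (restrictM ι β k)) (coefA a ε (-restrictM ι β k)) t') :
    (accSet ι β r a ε k).Nonempty ∧ accSet ι β r a ε k ≠ univ := by
  rcases psi_cases (theta a ε) (coefA a ε (restrictM ι β k)) (coefA a ε (-restrictM ι β k)) t with ht | ht <;>
    rcases psi_cases (theta a ε) (coefA a ε (restrictM ι β k)) (coefA a ε (-restrictM ι β k)) t' with ht' | ht'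
  · exact absurd (ht.trans ht'.symm) htt
  · refine ⟨⟨t' + r k, (mem_accSet_iff ι β r a ε k t').2 ht'⟩, fun hu => ?_⟩
    have h := (mem_accSet_iff ι β r a ε k t).1 (by rw [hu]; exact mem_univ _)
    rw [ht] at h; exact one_ne_zero' h.symm
  · refine ⟨⟨t + r k, (mem_accSet_iff ι β r a ε k t).2 ht⟩, fun hu => ?_⟩
    have h := (mem_accSet_iff ι β r a ε k t').1 (by rw [hu]; exact mem_univ _)
    rw [ht'] at h; exact one_ne_zero' h.symm
  · exact absurd (ht.trans ht'.symm) htt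

/-- **Genuine on `J'_ε`.** -/
theorem trivA_proper_of_mem (ι : Fin m ↪ Fin z) (β : Fin s → Fin z → ZMod 3) (r : Fin s → ZMod 3) (a : Fin m → Bool) (ε : ℕ)
    (k : Fin s) (hk : k ∈ decimSetE ι a β ε) : (trivA ι β r a ε k).Nonempty ∧ trivA ι β r a ε k ≠ univ := by
  unfold decimSetE decimSetY at hk
  rw [mem_filter, mem_filter] at hk
  obtain ⟨⟨-, c, hc, hβc⟩, t, t', htt⟩ := hk
  have hnot : ¬ ∀ c' : Out ι, β k c'.1 = 0 := fun h => hβc (h ⟨c, hc⟩)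
  unfold trivA
  rw [if_neg hnot]
  exact accSet_proper_of_ne ι β r a ε k htt

/-- **Trivial off `J'_ε`.** -/
theorem trivA_not_proper_of_not_mem (ι : Fin m ↪ Fin z) (β : Fin s → Fin z → ZMod 3) (r : Fin s → ZMod 3) (a : Fin m → Bool)
    (ε : ℕ) (hm : Odd m) (k : Fin s) (hk : k ∉ decimSetE ι a β ε) :
    ¬ ((trivA ι β r a ε k).Nonempty ∧ trivA ι β r a ε k ≠ univ) := by
  unfold trivA
  by_cases hδ : ∀ c : Out ι, β k c.1 = 0
  · rw [if_pos hδ]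
    split_ifs
    · exact fun h => h.2 rfl
    · exact fun h => (not_nonempty_empty h.1).elim
  · rw [if_neg hδ]
    by_cases hJ : k ∈ decimSet ι a β
    · -- in `J` and meeting `Y`, hence in `J_Y`; not in `J'_ε` means the decoded test is constant
      have hY : k ∈ decimSetY ι a β := by
        unfold decimSetY; rw [mem_filter]
        push Not at hδ
        obtain ⟨c, hc⟩ := hδ
        exact ⟨hJ, c.1, c.2, hc⟩
      have hconst : ∀ t t', psi (theta a ε) (coefA a ε (restrictM ι β k)) (coefA a ε (-restrictM ι β k)) t =
          psi (theta a ε) (coefA a ε (restrictM ι β k)) (coefA a ε (-restrictM ι β k)) t' := by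
        intro t t'
        by_contra hne
        exact hk (by unfold decimSetE; rw [mem_filter]; exact ⟨hY, t, t', hne⟩)
      rintro ⟨⟨v, hv⟩, hne⟩
      apply hne
      refine eq_univ_of_forall fun v' => ?_
      have hv1 := (mem_accSet_iff ι β r a ε k (v - r k)).1 (by rw [sub_add_cancel]; exact hv)
      have := (mem_accSet_iff ι β r a ε k (v' - r k)).2 (by rw [hconst (v' - r k) (v - r k)]; exact hv1)
      rwa [sub_add_cancel] at this
    · rw [accSet_eq_empty_of_not_mem_decimSet ι β r a ε hm k hJ]
      exact fun h => (not_nonempty_empty h.1).elim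

/-! ### The count for an arbitrary presentation of the long-pattern set; (NH_{s₀}) as its weight hypothesis -/

section Generic

variable {ι' : Type*} [Fintype ι'] [DecidableEq ι'] {κ : Type*} [Fintype κ] [DecidableEq κ]

/-- `card_parityClass_filter_le_mixed` for any presentation `P` of the long-pattern index set. -/
theorem card_parityClass_filter_le_mixed' (δ : κ → ι' → ZMod 3) (A : κ → Finset (ZMod 3)) (J : Finset κ)
    (hgen : ∀ k ∈ J, (A k).Nonempty ∧ A k ≠ univ) (htriv : ∀ k, k ∉ J → ¬ ((A k).Nonempty ∧ A k ≠ univ))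
    (hι : 0 < Fintype.card ι') (s₀ : ℕ)
    (hshort : (3 : ℝ)⁻¹ ^ J.card * ∑ t ∈ range (s₀ + 1), ((J.card.choose t : ℕ) : ℝ) * 4 ^ t ≤ 1 / 10)
    (P : Finset (κ → ZMod 3)) (hP : ∀ s', s' ∈ P ↔ (s₀ < ModTestProduct.wt s' ∧ ∀ k, k ∉ J → s' k = 0))
    (hlong : ∑ s' ∈ P, ((3 : ℝ) / 4) ^ ModTestProduct.wt (combo δ s') ≤ 1 / 100) (p c : ℕ) :
    ((univ.filter fun u : ι' → Bool =>
        (univ.filter fun i => u i = true).card % 2 = p % 2 ∧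
        (univ.filter fun k => ModTestProduct.subsetSum (δ k) u ∈ A k).card % 2 = c % 2).card : ℝ)
      ≤ 7 / 8 * (2 : ℝ) ^ (Fintype.card ι' - 1) := by
  have e : P = univ.filter (fun s' : κ → ZMod 3 => s₀ < ModTestProduct.wt s' ∧ ∀ k, k ∉ J → s' k = 0) := by
    ext s'; rw [hP]; simp
  rw [e] at hlong
  exact card_parityClass_filter_le_mixed δ A J hgen htriv hι s₀ hshort hlong p c

end Generic

/-- **The long `3/4`-mass of (NH_{s₀}) at `J'_ε` is the weight hypothesis of the mixed count** (outside-coin form). -/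
theorem nhsE_long_sum_le (ι : Fin m ↪ Fin z) (a : Fin m → Bool) (β : Fin s → Fin z → ZMod 3) {ε s₀ : ℕ}
    (h : NHsE ι a β ε s₀) (P : Finset (Fin s → ZMod 3))
    (hP : ∀ j, j ∈ P ↔ (s₀ < ModTestProduct.wt j ∧ ∀ k, k ∉ decimSetE ι a β ε → j k = 0)) :
    ∑ j ∈ P, ((3 : ℝ) / 4) ^ ModTestProduct.wt (combo (dirOut ι β) j) ≤ 1 / 100 := by
  obtain ⟨-, h2⟩ := h
  refine le_trans (le_of_eq ?_) h2
  refine Finset.sum_congr ?_ fun j _ => by rw [wt_combo_dirOut]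
  ext j
  rw [hP j]
  simp only [mem_filter, mem_univ, true_and]
  rfl

/-! ### Theorem 38.F -/

/-- **Theorem 38.F, memo-exact form (`FibreNonExact38E`) — PROVED.** -/
theorem fibreNonExact38E : FibreNonExact38E := by
  intro z s m ι β r k₀ a s₀ hm hz _ _ ε μ₀ S hN
  -- the coset, its agreement and disagreement parts
  set agree : (Fin z → Bool) → Prop := fun u => testParity β r u % 2 = affTarget μ₀ S u % 2 with hagree
  have hHcard : ((coset z ε).card : ℝ) = (2 : ℝ) ^ (z - 1) := by
    have h := card_parityClass (ι := Fin z) (by rw [Fintype.card_fin]; omega) ε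
    rw [Fintype.card_fin] at h
    exact h
  have hsplitH := card_filter_add_card_filter_not (s := coset z ε) agree
  set D : Finset (Fin z → Bool) := (coset z ε).filter fun u => ¬ agree u with hD
  have hn : Fintype.card (Out ι) = z - m := card_out ι
  have hnpos : 0 < Fintype.card (Out ι) := by rw [hn]; exact hz
  set Yev : Finset (Out ι → Bool) := univ.filter fun y => (univ.filter fun c => y c = true).card % 2 = 0 % 2 with hYev
  have hYcard : (Yev.card : ℝ) = (2 : ℝ) ^ (z - m - 1) := by
    rw [← hn]; exact card_parityClass hnpos 0
  -- STEP 1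
  set res : (Fin z → Bool) → (Out ι → Bool) := fun u c => u c.1 with hres
  set Bset : Finset (Out ι → Bool) := Yev.filter fun y => ∃ u ∈ D, res u = y with hBset
  set Good : Finset (Out ι → Bool) := Yev.filter fun y => ¬ ∃ u ∈ D, res u = y with hGood
  have hsplitY := card_filter_add_card_filter_not (s := Yev) (fun y => ∃ u ∈ D, res u = y)
  have hBD : Bset.card ≤ D.card := by
    refine Finset.card_le_card_of_injOn
      (fun y => if h : ∃ u ∈ D, res u = y then h.choose else fun _ => false) (fun y hy => ?_) ?_
    · obtain ⟨-, h⟩ := mem_filter.1 hy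
      simp only [dif_pos h]
      exact h.choose_spec.1
    · intro y hy y' hy' heq
      obtain ⟨-, h⟩ := mem_filter.1 (mem_coe.1 hy)
      obtain ⟨-, h'⟩ := mem_filter.1 (mem_coe.1 hy')
      simp only [dif_pos h, dif_pos h'] at heq
      calc y = res h.choose := h.choose_spec.2.symm
        _ = res h'.choose := by rw [heq]
        _ = y' := h'.choose_spec.2
  -- STEP 2 + Lemma 38.C
  have hGoodP : Good ⊆ univ.filter fun y : Out ι → Bool =>
      (univ.filter fun c => y c = true).card % 2 = 0 % 2 ∧
        (univ.filter fun k => ModTestProduct.subsetSum (dirOut ι β k) y ∈ trivA ι β r a ε k).card % 2 = cStar ι a ε S % 2 := by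
    intro y hy
    obtain ⟨hyev, hgood⟩ := mem_filter.1 hy
    obtain ⟨-, hy0⟩ := mem_filter.1 hyev
    refine mem_filter.2 ⟨mem_univ _, hy0, ?_⟩
    rw [filter_trivA_eq]
    refine good_fibre_parity ι β r a μ₀ ε S hm y (by omega) fun u hu hres' => ?_
    by_contra hne
    exact hgood ⟨u, mem_filter.2 ⟨hu, hne⟩, hres'⟩
  have hshort : (3 : ℝ)⁻¹ ^ (decimSetE ι a β ε).card *
      ∑ t ∈ range (s₀ + 1), (((decimSetE ι a β ε).card.choose t : ℕ) : ℝ) * 4 ^ t ≤ 1 / 10 := hN.1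
  set P : Finset (Fin s → ZMod 3) := (univ : Finset (Fin s → ZMod 3)).filter
    (fun j => s₀ < relSuppCard j ∧ ∀ k, k ∉ decimSetE ι a β ε → j k = 0) with hPdef
  have hPmem : ∀ j, j ∈ P ↔ (s₀ < ModTestProduct.wt j ∧ ∀ k, k ∉ decimSetE ι a β ε → j k = 0) := by
    intro j
    rw [hPdef, mem_filter]
    unfold relSuppCard ModTestProduct.wt
    simp only [mem_univ, true_and]
  have hP := card_parityClass_filter_le_mixed' (dirOut ι β) (trivA ι β r a ε) (decimSetE ι a β ε)
    (fun k hk => trivA_proper_of_mem ι β r a ε k hk) (fun k hk => trivA_not_proper_of_not_mem ι β r a ε hm k hk) hnpos s₀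
    hshort P hPmem (nhsE_long_sum_le ι a β hN P hPmem) 0 (cStar ι a ε S)
  rw [hn] at hP
  have hGoodNat : Good.card ≤ _ := card_le_card hGoodP
  have hGood : (Good.card : ℝ) ≤ 7 / 8 * (2 : ℝ) ^ (z - m - 1) := (Nat.cast_le.2 hGoodNat).trans hP
  -- assembly
  have hsplitHR : (((coset z ε).filter agree).card : ℝ) + (D.card : ℝ) = (2 : ℝ) ^ (z - 1) := by
    rw [← hHcard]; exact_mod_cast hsplitH
  have hsplitYR : (Bset.card : ℝ) + (Good.card : ℝ) = (2 : ℝ) ^ (z - m - 1) := by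
    rw [← hYcard]; exact_mod_cast hsplitY
  have hBDR : (Bset.card : ℝ) ≤ (D.card : ℝ) := by exact_mod_cast hBD
  have hpow : (2 : ℝ) ^ (z - 1) = (2 : ℝ) ^ m * (2 : ℝ) ^ (z - m - 1) := by
    rw [← pow_add]; congr 1; omega
  have hinv : (2 : ℝ)⁻¹ ^ (m + 3) * ((2 : ℝ) ^ m * (2 : ℝ) ^ (z - m - 1)) = (2 : ℝ) ^ (z - m - 1) / 8 := by
    obtain ⟨X, hX⟩ : ∃ X : ℝ, X = (2 : ℝ)⁻¹ ^ (m + 3) := ⟨_, rfl⟩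
    have h1 : X * (2 : ℝ) ^ (m + 3) = 1 := by
      rw [hX, ← mul_pow]; norm_num
    have h28 : (2 : ℝ) ^ (m + 3) = (2 : ℝ) ^ m * 8 := by rw [pow_add]; norm_num
    rw [h28] at h1
    rw [← hX]
    calc X * ((2 : ℝ) ^ m * (2 : ℝ) ^ (z - m - 1)) = X * ((2 : ℝ) ^ m * 8) * (2 : ℝ) ^ (z - m - 1) / 8 := by ring
      _ = (2 : ℝ) ^ (z - m - 1) / 8 := by rw [h1, one_mul]
  rw [show (((coset z ε).filter fun u => testParity β r u % 2 = affTarget μ₀ S u % 2).card : ℝ) =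
      (((coset z ε).filter agree).card : ℝ) from rfl]
  rw [hpow, sub_mul, one_mul, hinv]
  linarith

/-- **Theorem 38.F, syntactic corrected form (`FibreNonExact38R`) — PROVED** (via p2's reduction `fibreNonExact38R_of_E`). -/
theorem fibreNonExact38R : FibreNonExact38R := fibreNonExact38R_of_E subrowNonconst fibreNonExact38E

end Summit.QuantumAdvantage.AdviceFreeQNC0.Exp38p2

end
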